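import Mathlib
import HarnessLib
import Summits.HubbardSuperconductivity.HubbardSuperconductivity.Theorems.KLProgrammeKLRegimeEngineTowerBlockZeroWtFull

/-!
# Route `KLProgramme` — crux K3 ENGINE (stmt-HubbardSuperconductivity-20437 `KLRegimeEngineV17F2`), stub (b) v2, THE LEVELS PACKAGE (ℓ):
# instantiation (I1), BLOCK `0`, LEVELLED tracks — every levelled norm of `Δ_0` and the born arrays `klTowerBornLev … d 0 m F` in kit form
# (E1-LEVELS-BLUEPRINT v5 §1 (β); continuation of `…TowerBlockZeroWt` / `…TowerBlockZeroWtFull`; cell gate-hubbard-kl, seat hubbard-kl-k3c2-p3 g12 as SUBSTITUTE typer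
#  while the E1 lineage is unseated — E1 may rename or supersede)

Block `0`'s increment `Δ_0 = 𝒱_d − 𝒱_0` as ONE Gaussian step `C^K_{(Λ_d, Λ_0]}` from the scale-`0` action read in the TRIVIAL family (all plateau facts trivial, child =
support overlap, parents count `ρc = 1`), now in E1's LEVELLED currency `klLevNormOf` through this seat's output bridge `klLevNormOf_le_of_forall_doorSum_le`
(…TowerLevBridge) and the PLAIN prescribed doors (`Literature/…/SectorisedIncrementBoundGradedPrescribedPlateau`, `…BinomialPrescribedPlateau`):

* **`klLevNormOf_klTowerIncr_zero_le_kit`** — for `Z^K_{Λ_0} ≠ 0`, the UNWEIGHTED block-`0` constants at the trivial family (Gram `κ`, rows/cols `α` of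
  `S(1)ᵀC^K_{(Λ_d,Λ_0]}S(1)`, overlap `(cr, cc)` of `E(F_{J′})·S(1)`, `ρ`), PRESCRIBED plain input sizes `B m′ Fc` of `𝒱_0` (the doors' `(E, τ)`-filter form; in the trivial
  family a «prescribed label» fixes spin and charge only) with a track-blind majorant `N` (`ε·B m c ≤ N m`, `N 0 = 0`), kit parameters and the kit guard: for EVERY
  prescription `Ωe` at the output family `F_{J′}`,
  `klLevNormOf … J′ (2q+2) Δ_0 Ωe ≤ ε^{2q+1}·(cr·cc^{2q+1}·(Σ e·Φ^{n−1}·ψ^{q+1}·towerS + ψ^{q+1}·tail) + cr·cc^{2q+1}·((e²)^{q+2}/2·towerFO D κ² N (q+1)))`;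
* **`klTowerBornLev_zero_le_kit`** — the carrier row at the born family `F_0`, every level count `F` (`ciSup`; an empty level gives `0 ≤` the same).
Compositions of landed theorems; nothing about the model is asserted beyond them; nothing asserts (ℓ), any stub, K3 or superconductivity.
References: BGM 2006 §2.7 (2.70)–(2.71a), §2.8 (2.76)–(2.84), (2.88)–(2.90), §3 (3.2)–(3.8) [cite: BenfattoGiulianiMastropietro2006].
-/

noncomputable section

namespace Summit.HubbardSuperconductivity.HubbardSuperconductivity.Theorems.EngineV8

set_option linter.dupNamespace false -- summit = problem name (single-conjunct summit), D-0017

open Classical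
open Real Finset Literature.MathematicalPhysics.QuantumLattice Literature.Probability.LatticeModels GrassmannAlgebra
open Literature.MathematicalPhysics.QuantumLattice.FermiRG
open Summit.HubbardSuperconductivity.HubbardSuperconductivity.Theorems.KLProgrammeLegKernels
open Summit.HubbardSuperconductivity.HubbardSuperconductivity.Theorems.KLRegimeSplit
open Summit.HubbardSuperconductivity.HubbardSuperconductivity.Theorems.KLRegimeWick
open Summit.HubbardSuperconductivity.HubbardSuperconductivity.Theorems.TwoPointAssembly
open Summit.HubbardSuperconductivity.HubbardSuperconductivity.Theorems.DispersionFlow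
open scoped Nat

variable {L M : ℕ} [NeZero L] [NeZero M]

/-- **BLOCK `0`, EVERY LEVELLED NORM OF `Δ_0` IN KIT FORM.**  `Z^K_{Λ_0} ≠ 0`; UNWEIGHTED block-`0` constants at the trivial input family; PRESCRIBED plain input
sizes `B m′ Fc` of `𝒱_0` with a track-blind majorant `N ≥ 0`, `N 0 = 0`, `ε·B m c ≤ N m`; degree cap `D`; kit parameters `τ, ψ`; KIT guard.  Then for every `Ωe`:
`klLevNormOf … J′ (2q+2) Δ_0 Ωe ≤ ε^{2q+1}·(cr·cc^{2q+1}·(Σ + tail) + cr·cc^{2q+1}·((e²)^{q+2}/2·towerFO))`. -/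
theorem klLevNormOf_klTowerIncr_zero_le_kit {β : ℝ} (hβ : 0 < β) (U μ : ℝ) (K : TrigPolyC4v) (d J' : ℕ)
    (hZ : hubbardEffPartitionFnCT L M β U μ 0 K (klScale klE0 0) ≠ 0)
    {κ : ℝ} (hκ : 0 < κ)
    (hGB : IsGramBoundedR ((sectorSubMatrix L M β (trivialMultiplier L M)).transpose *
      hubbardCovSliceCT L M β μ 0 K (klScale klE0 d) (klScale klE0 0) * sectorSubMatrix L M β (trivialMultiplier L M)) κ)
    (B : ℕ → ℕ → ℝ) (hB0 : ∀ m' Fc, 0 ≤ B m' Fc)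
    (hB : ∀ (m' Fc : ℕ) (E : Finset (Fin (2 * m' + 1 + 1))) (τ' : Fin (2 * m' + 1 + 1) → SectorLeg 1)
      (q : Fin (2 * m' + 1 + 1)), q ∈ E → E.card = Fc + 1 → ∀ y : SpaceTimeIdx L M,
        imagTimeWeight β M ^ (2 * m' + 1) *
          ∑ σ ∈ univ.filter (fun σ : Fin (2 * m' + 1 + 1) → SectorLeg 1 => ∀ e ∈ E, σ e = τ' e),
            ∑ x ∈ univ.filter (fun x : Fin (2 * m' + 1 + 1) → SpaceTimeIdx L M => x q = y),
              ‖sectorisedKernel L M β (trivialMultiplier L M) (klEffectiveAction L M β U μ K klE0 0) (2 * m' + 1 + 1) σ x‖ ≤ B (m' + 1) Fc)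
    {α : ℝ} (hα : 0 < α)
    (hrow : ∀ X, ∑ Y, ‖((sectorSubMatrix L M β (trivialMultiplier L M)).transpose *
        hubbardCovSliceCT L M β μ 0 K (klScale klE0 d) (klScale klE0 0) * sectorSubMatrix L M β (trivialMultiplier L M)) X Y‖ ≤ α)
    (hcol : ∀ Y, ∑ X, ‖((sectorSubMatrix L M β (trivialMultiplier L M)).transpose *
        hubbardCovSliceCT L M β μ 0 K (klScale klE0 d) (klScale klE0 0) * sectorSubMatrix L M β (trivialMultiplier L M)) X Y‖ ≤ α)
    {ρ : ℝ} (hρ : 0 < ρ)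
    {cr cc : ℝ} (hcr0 : 0 ≤ cr) (hcc0 : 0 ≤ cc)
    (hrow' : ∀ X'', ∑ X', ‖(sectorAnalysisMatrix L M β (klAnisoFamily L M β μ K klE0 J') * sectorSubMatrix L M β (trivialMultiplier L M)) X'' X'‖ ≤ cr)
    (hcol' : ∀ X', ∑ X'', ‖(sectorAnalysisMatrix L M β (klAnisoFamily L M β μ K klE0 J') * sectorSubMatrix L M β (trivialMultiplier L M)) X'' X'‖ ≤ cc)
    {N₀ : ℕ} (hN₀ : 2 ≤ N₀)
    {N : ℕ → ℝ} (hN0 : ∀ m, 0 ≤ N m) (hN00 : N 0 = 0) (hNB : ∀ m c, (1 : ℝ) ^ c * (imagTimeWeight β M * B m c) ≤ N m)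
    {D : ℕ} (hD : Fintype.card (SpaceTimeIdx L M × SectorLeg 1) / 2 ≤ D)
    {τ ψ : ℝ} (hτ1 : (exp 3 * κ) ^ 2 ≤ τ) (hτ2 : (exp 2 * (κ + ρ)) ^ 2 ≤ τ) (hψ1 : κ⁻¹ ^ 2 ≤ ψ) (hψ2 : ρ⁻¹ ^ 2 ≤ ψ)
    (hguard : exp 1 * α / κ ^ 2 * towerV D τ N < 1) (q : ℕ) (Ωe : Fin (2 * q + 1 + 1) → Option (SectorLeg (sectorCount J'))) :
    klLevNormOf L M β μ K J' (2 * q + 1 + 1) (klTowerIncr L M β U μ K d 0) Ωe ≤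
      imagTimeWeight β M ^ (2 * q + 1) *
        (cr * cc ^ (2 * q + 1) *
            (∑ n ∈ Icc 2 (N₀ - 1), exp 1 * (exp 1 * α / κ ^ 2) ^ (n - 1) * ψ ^ (q + 1) * towerS D τ N n (q + 1) +
              ψ ^ (q + 1) * (exp 1 * towerV D τ N * (exp 1 * α / κ ^ 2 * towerV D τ N) ^ (N₀ - 1) / (1 - exp 1 * α / κ ^ 2 * towerV D τ N))) +
          cr * cc ^ (2 * q + 1) * (exp 2 ^ (q + 2) / 2 * towerFO D (κ ^ 2) N (q + 1))) := by
  have hβ' : β ≠ 0 := hβ.ne'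
  have hε : 0 ≤ imagTimeWeight β M := imagTimeWeight_nonneg hβ.le M
  have h10 : (0 : ℝ) ≤ 1 := zero_le_one
  have hG : klEffectiveAction L M β U μ K klE0 0 ∈ evenPart ℂ (HubbardFieldIdx L M) := klEffectiveAction_mem_evenPart hβ' U μ K klE0 0
  have hG0 : constPart ℂ (klEffectiveAction L M β U μ K klE0 0) = 0 := constPart_klEffectiveAction_eq_zero β U μ K klE0 0 hZ
  -- `Δ_0` as one Gaussian step from `𝒱_0`
  have hZ' : hubbardEffPartitionFnCT L M β U μ 0 K (klScale klE0 (d * 0)) ≠ 0 := by rwa [Nat.mul_zero]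
  have hΔ := klTowerIncr_eq_ordersGe2_add_firstOrder β U μ K d 0 hZ'
  simp only [Nat.mul_zero, zero_add, mul_one, klTowerInput] at hΔ
  -- signs of the kit terms
  set Φ := exp 1 * α / κ ^ 2 with hΦ
  set FO := towerFO D (κ ^ 2) N (q + 1) with hFO
  set S := ∑ n ∈ Icc 2 (N₀ - 1), exp 1 * Φ ^ (n - 1) * ψ ^ (q + 1) * towerS D τ N n (q + 1) with hS
  set T := ψ ^ (q + 1) * (exp 1 * towerV D τ N * (Φ * towerV D τ N) ^ (N₀ - 1) / (1 - Φ * towerV D τ N)) with hT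
  have hτ0 : 0 ≤ τ := le_trans (by positivity) hτ1
  have hψ0 : 0 ≤ ψ := le_trans (by positivity) hψ1
  have hΦ0 : 0 ≤ Φ := by rw [hΦ]; positivity
  have hFO0 : 0 ≤ FO := towerFO_nonneg (by positivity) hN0 _
  have hS0 : 0 ≤ S := sum_nonneg fun n _ => by
    have := towerS_nonneg (D := D) hτ0 hN0 n (q + 1); positivity
  have hT0 : 0 ≤ T := by
    have hV := towerV_nonneg (D := D) hτ0 hN0
    exact mul_nonneg (pow_nonneg hψ0 _) (div_nonneg (by positivity) (sub_nonneg.2 hguard.le))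
  have hC0 : 0 ≤ imagTimeWeight β M ^ (2 * q + 1) * (cr * cc ^ (2 * q + 1) * (S + T) + cr * cc ^ (2 * q + 1) * (exp 2 ^ (q + 2) / 2 * FO)) := by
    positivity
  -- the door guard from the kit guard
  have hV := normV_prescribed_le_towerV (Γ := SpaceTimeIdx L M × SectorLeg 1) (ρc := (1 : ℝ)) (ε := imagTimeWeight β M)
    hκ.le hρ.le (B := B) hN0 hN00 hNB hD hτ2
  have hθ : Real.exp 1 * α * normV (SpaceTimeIdx L M × SectorLeg 1) κ ρ (fun m' => (1 : ℝ) ^ 0 * (imagTimeWeight β M * B m' 0)) / κ ^ 2 < 1 := by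
    calc Real.exp 1 * α * normV (SpaceTimeIdx L M × SectorLeg 1) κ ρ (fun m' => (1 : ℝ) ^ 0 * (imagTimeWeight β M * B m' 0)) / κ ^ 2
        = Φ * normV (SpaceTimeIdx L M × SectorLeg 1) κ ρ (fun m' => (1 : ℝ) ^ 0 * (imagTimeWeight β M * B m' 0)) := by rw [hΦ]; ring
      _ ≤ Φ * towerV D τ N := mul_le_mul_of_nonneg_left hV hΦ0
      _ < 1 := hguard
  -- the output bridge
  refine klLevNormOf_le_of_forall_doorSum_le hβ.le μ K J' (klTowerIncr L M β U μ K d 0) Ωe hC0 fun p s x => ?_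
  set J : Finset (Fin (2 * q + 1 + 1)) := univ.filter (fun i : Fin (2 * q + 1 + 1) => (Ωe i).isSome ∧ i ≠ p) with hJdef
  have hp : p ∉ J := by rw [hJdef, mem_filter]; exact fun h => h.2.2 rfl
  -- the two plain prescribed doors at the trivial family
  have h2 := sum_filter_norm_sectorAnalysis_effAction_sub_gaussConv_le_graded_prescribed_of_plateau hβ (trivialMultiplier L M) (trivialMultiplier L M)
    trivialMultiplier_mul_self trivialMultiplier_eq_zero_of_sum_eq_zero (klAnisoFamily L M β μ K klE0 J') (klEffectiveAction L M β U μ K klE0 0) hG hG0 _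
    (sum_trivialMultiplier_eq_one_of_ne_zero (hubbardCovSliceCT L M β μ 0 K (klScale klE0 d) (klScale klE0 0)))
    (sum_trivialMultiplier_eq_one_of_family_ne_zero (klAnisoFamily L M β μ K klE0 J'))
    (fun ω'' ω' => ∃ p' : FreqMomentum L M, klAnisoFamily L M β μ K klE0 J' ω'' p' ≠ 0 ∧ trivialMultiplier L M ω' p' ≠ 0)
    (fun X'' X' hne => overlap_of_sectorAnalysis_mul_sectorSub_ne_zero β _ _ X'' X' hne)
    h10 (fun ℓ'' => by
      convert card_parents_trivialMultiplier_le_one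
        (fun ω'' ω' => ∃ p' : FreqMomentum L M, klAnisoFamily L M β μ K klE0 J' ω'' p' ≠ 0 ∧ trivialMultiplier L M ω' p' ≠ 0) ℓ'' using 4)
    hκ hGB B hB0 hB hα hrow hcol hρ hθ hcc0 hrow' hcol' hN₀ (m := 2 * q + 1) p J hp (fun j => (Ωe j).getD s) (x, s)
  have h1 := sum_filter_norm_sectorAnalysis_gaussConv_sub_le_binomial_prescribed_of_plateau hβ (trivialMultiplier L M) (trivialMultiplier L M)
    trivialMultiplier_mul_self trivialMultiplier_eq_zero_of_sum_eq_zero (klAnisoFamily L M β μ K klE0 J') (klEffectiveAction L M β U μ K klE0 0) hG _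
    (sum_trivialMultiplier_eq_one_of_ne_zero (hubbardCovSliceCT L M β μ 0 K (klScale klE0 d) (klScale klE0 0)))
    (sum_trivialMultiplier_eq_one_of_family_ne_zero (klAnisoFamily L M β μ K klE0 J'))
    (fun ω'' ω' => ∃ p' : FreqMomentum L M, klAnisoFamily L M β μ K klE0 J' ω'' p' ≠ 0 ∧ trivialMultiplier L M ω' p' ≠ 0)
    (fun X'' X' hne => overlap_of_sectorAnalysis_mul_sectorSub_ne_zero β _ _ X'' X' hne)
    h10 (fun ℓ'' => by
      convert card_parents_trivialMultiplier_le_one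
        (fun ω'' ω' => ∃ p' : FreqMomentum L M, klAnisoFamily L M β μ K klE0 J' ω'' p' ≠ 0 ∧ trivialMultiplier L M ω' p' ≠ 0) ℓ'' using 4)
    hκ.le hGB B hB0 hB hcc0 hrow' hcol' (q := q) p J hp (fun j => (Ωe j).getD s) (x, s)
  -- dominate the brackets by the kit terms
  have hgr := doorGradedPrescribed_le_kitStep (Γ := SpaceTimeIdx L M × SectorLeg 1) (Jt := ↥J)
    hκ hρ hα.le h10 hε hB0 hN0 hN00 hNB hD hN₀ (m := 2 * q + 1) (p := q + 1) (by ring) hτ1 hτ2 hψ1 hψ2 hguard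
  rw [Fintype.card_coe] at hgr
  have hfo := doorBinomialPrescribedJ_le_towerFO (κ := κ) (ρc := (1 : ℝ)) (ε := imagTimeWeight β M) hκ.le h10 hε hB0 (N := N) hNB hD q J
  have h2' := h2.trans (mul_le_mul_of_nonneg_left hgr (by positivity))
  have h1' := h1.trans (mul_le_mul_of_nonneg_left hfo (by positivity))
  -- split `Δ_0` inside the door-form sum
  rw [hΔ, map_add]
  have hsplit : ∀ X : Fin (2 * q + 1 + 1) → SpaceTimeIdx L M × SectorLeg (sectorCount J'),
      ‖kernel ℂ (ExteriorAlgebra.map (Matrix.toLin' (sectorAnalysisMatrix L M β (klAnisoFamily L M β μ K klE0 J')))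
            (effAction ℂ (hubbardCovSliceCT L M β μ 0 K (klScale klE0 d) (klScale klE0 0)) (klEffectiveAction L M β U μ K klE0 0) -
              gaussConv ℂ (hubbardCovSliceCT L M β μ 0 K (klScale klE0 d) (klScale klE0 0)) (klEffectiveAction L M β U μ K klE0 0)) +
          ExteriorAlgebra.map (Matrix.toLin' (sectorAnalysisMatrix L M β (klAnisoFamily L M β μ K klE0 J')))
            (gaussConv ℂ (hubbardCovSliceCT L M β μ 0 K (klScale klE0 d) (klScale klE0 0)) (klEffectiveAction L M β U μ K klE0 0) -
              klEffectiveAction L M β U μ K klE0 0)) (2 * q + 1 + 1) X‖ ≤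
        ‖kernel ℂ (ExteriorAlgebra.map (Matrix.toLin' (sectorAnalysisMatrix L M β (klAnisoFamily L M β μ K klE0 J')))
            (effAction ℂ (hubbardCovSliceCT L M β μ 0 K (klScale klE0 d) (klScale klE0 0)) (klEffectiveAction L M β U μ K klE0 0) -
              gaussConv ℂ (hubbardCovSliceCT L M β μ 0 K (klScale klE0 d) (klScale klE0 0)) (klEffectiveAction L M β U μ K klE0 0)))
            (2 * q + 1 + 1) X‖ +
        ‖kernel ℂ (ExteriorAlgebra.map (Matrix.toLin' (sectorAnalysisMatrix L M β (klAnisoFamily L M β μ K klE0 J')))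
            (gaussConv ℂ (hubbardCovSliceCT L M β μ 0 K (klScale klE0 d) (klScale klE0 0)) (klEffectiveAction L M β U μ K klE0 0) -
              klEffectiveAction L M β U μ K klE0 0)) (2 * q + 1 + 1) X‖ := fun X => by
    rw [kernel_add]; exact norm_add_le _ _
  calc imagTimeWeight β M ^ (2 * q + 1) * _
      ≤ imagTimeWeight β M ^ (2 * q + 1) * (_ + _) := by
        refine mul_le_mul_of_nonneg_left ((sum_le_sum fun X _ => hsplit X).trans (le_of_eq (sum_add_distrib))) (pow_nonneg hε _)
    _ ≤ imagTimeWeight β M ^ (2 * q + 1) * (cr * cc ^ (2 * q + 1) * (S + T) + cr * cc ^ (2 * q + 1) * (exp 2 ^ (q + 2) / 2 * FO)) :=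
        mul_le_mul_of_nonneg_left (add_le_add h2' h1') (pow_nonneg hε _)

/-- **BLOCK `0`'S BORN LEVELLED ARRAYS IN KIT FORM, EVERY LEVEL COUNT** (born family `F_0`): `klTowerBornLev … d 0 (2(q+1)) F ≤ ε^{2q+1}·(cr·cc^{2q+1}·(Σ + tail) +
cr·cc^{2q+1}·((e²)^{q+2}/2·towerFO))` — the `k = 0` complement of `klTowerBornLev_le_kit` (p642896). -/
theorem klTowerBornLev_zero_le_kit {β : ℝ} (hβ : 0 < β) (U μ : ℝ) (K : TrigPolyC4v) (d : ℕ)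
    (hZ : hubbardEffPartitionFnCT L M β U μ 0 K (klScale klE0 0) ≠ 0)
    {κ : ℝ} (hκ : 0 < κ)
    (hGB : IsGramBoundedR ((sectorSubMatrix L M β (trivialMultiplier L M)).transpose *
      hubbardCovSliceCT L M β μ 0 K (klScale klE0 d) (klScale klE0 0) * sectorSubMatrix L M β (trivialMultiplier L M)) κ)
    (B : ℕ → ℕ → ℝ) (hB0 : ∀ m' Fc, 0 ≤ B m' Fc)
    (hB : ∀ (m' Fc : ℕ) (E : Finset (Fin (2 * m' + 1 + 1))) (τ' : Fin (2 * m' + 1 + 1) → SectorLeg 1)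
      (q : Fin (2 * m' + 1 + 1)), q ∈ E → E.card = Fc + 1 → ∀ y : SpaceTimeIdx L M,
        imagTimeWeight β M ^ (2 * m' + 1) *
          ∑ σ ∈ univ.filter (fun σ : Fin (2 * m' + 1 + 1) → SectorLeg 1 => ∀ e ∈ E, σ e = τ' e),
            ∑ x ∈ univ.filter (fun x : Fin (2 * m' + 1 + 1) → SpaceTimeIdx L M => x q = y),
              ‖sectorisedKernel L M β (trivialMultiplier L M) (klEffectiveAction L M β U μ K klE0 0) (2 * m' + 1 + 1) σ x‖ ≤ B (m' + 1) Fc)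
    {α : ℝ} (hα : 0 < α)
    (hrow : ∀ X, ∑ Y, ‖((sectorSubMatrix L M β (trivialMultiplier L M)).transpose *
        hubbardCovSliceCT L M β μ 0 K (klScale klE0 d) (klScale klE0 0) * sectorSubMatrix L M β (trivialMultiplier L M)) X Y‖ ≤ α)
    (hcol : ∀ Y, ∑ X, ‖((sectorSubMatrix L M β (trivialMultiplier L M)).transpose *
        hubbardCovSliceCT L M β μ 0 K (klScale klE0 d) (klScale klE0 0) * sectorSubMatrix L M β (trivialMultiplier L M)) X Y‖ ≤ α)
    {ρ : ℝ} (hρ : 0 < ρ)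
    {cr cc : ℝ} (hcr0 : 0 ≤ cr) (hcc0 : 0 ≤ cc)
    (hrow' : ∀ X'', ∑ X', ‖(sectorAnalysisMatrix L M β (klAnisoFamily L M β μ K klE0 0) * sectorSubMatrix L M β (trivialMultiplier L M)) X'' X'‖ ≤ cr)
    (hcol' : ∀ X', ∑ X'', ‖(sectorAnalysisMatrix L M β (klAnisoFamily L M β μ K klE0 0) * sectorSubMatrix L M β (trivialMultiplier L M)) X'' X'‖ ≤ cc)
    {N₀ : ℕ} (hN₀ : 2 ≤ N₀)
    {N : ℕ → ℝ} (hN0 : ∀ m, 0 ≤ N m) (hN00 : N 0 = 0) (hNB : ∀ m c, (1 : ℝ) ^ c * (imagTimeWeight β M * B m c) ≤ N m)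
    {D : ℕ} (hD : Fintype.card (SpaceTimeIdx L M × SectorLeg 1) / 2 ≤ D)
    {τ ψ : ℝ} (hτ1 : (exp 3 * κ) ^ 2 ≤ τ) (hτ2 : (exp 2 * (κ + ρ)) ^ 2 ≤ τ) (hψ1 : κ⁻¹ ^ 2 ≤ ψ) (hψ2 : ρ⁻¹ ^ 2 ≤ ψ)
    (hguard : exp 1 * α / κ ^ 2 * towerV D τ N < 1) (q F : ℕ) :
    klTowerBornLev L M β U μ K d 0 (2 * (q + 1)) F ≤
      imagTimeWeight β M ^ (2 * q + 1) *
        (cr * cc ^ (2 * q + 1) *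
            (∑ n ∈ Icc 2 (N₀ - 1), exp 1 * (exp 1 * α / κ ^ 2) ^ (n - 1) * ψ ^ (q + 1) * towerS D τ N n (q + 1) +
              ψ ^ (q + 1) * (exp 1 * towerV D τ N * (exp 1 * α / κ ^ 2 * towerV D τ N) ^ (N₀ - 1) / (1 - exp 1 * α / κ ^ 2 * towerV D τ N))) +
          cr * cc ^ (2 * q + 1) * (exp 2 ^ (q + 2) / 2 * towerFO D (κ ^ 2) N (q + 1))) := by
  have hε : 0 ≤ imagTimeWeight β M := imagTimeWeight_nonneg hβ.le M
  have hτ0 : 0 ≤ τ := le_trans (by positivity) hτ1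
  have hψ0 : 0 ≤ ψ := le_trans (by positivity) hψ1
  have hRHS : 0 ≤ imagTimeWeight β M ^ (2 * q + 1) *
      (cr * cc ^ (2 * q + 1) *
          (∑ n ∈ Icc 2 (N₀ - 1), exp 1 * (exp 1 * α / κ ^ 2) ^ (n - 1) * ψ ^ (q + 1) * towerS D τ N n (q + 1) +
            ψ ^ (q + 1) * (exp 1 * towerV D τ N * (exp 1 * α / κ ^ 2 * towerV D τ N) ^ (N₀ - 1) / (1 - exp 1 * α / κ ^ 2 * towerV D τ N))) +
        cr * cc ^ (2 * q + 1) * (exp 2 ^ (q + 2) / 2 * towerFO D (κ ^ 2) N (q + 1))) := by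
    have hFO0 : 0 ≤ towerFO D (κ ^ 2) N (q + 1) := towerFO_nonneg (by positivity) hN0 _
    have hS0 : 0 ≤ ∑ n ∈ Icc 2 (N₀ - 1), exp 1 * (exp 1 * α / κ ^ 2) ^ (n - 1) * ψ ^ (q + 1) * towerS D τ N n (q + 1) :=
      sum_nonneg fun n _ => by have := towerS_nonneg (D := D) hτ0 hN0 n (q + 1); positivity
    have hT0 : 0 ≤ ψ ^ (q + 1) * (exp 1 * towerV D τ N * (exp 1 * α / κ ^ 2 * towerV D τ N) ^ (N₀ - 1) /
        (1 - exp 1 * α / κ ^ 2 * towerV D τ N)) := by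
      have hV := towerV_nonneg (D := D) hτ0 hN0
      exact mul_nonneg (pow_nonneg hψ0 _) (div_nonneg (by positivity) (sub_nonneg.2 hguard.le))
    positivity
  unfold klTowerBornLev
  rcases isEmpty_or_nonempty {Ωe : Fin (2 * (q + 1)) → Option (SectorLeg (sectorCount (d * 0))) // levelCount Ωe = F} with h | h
  · rw [Real.iSup_of_isEmpty]; exact hRHS
  · refine ciSup_le fun Ωe => ?_
    exact klLevNormOf_klTowerIncr_zero_le_kit (L := L) (M := M) hβ U μ K d (d * 0) hZ hκ hGB B hB0 hB hα hrow hcol hρ hcr0 hcc0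
      (by simpa only [Nat.mul_zero] using hrow') (by simpa only [Nat.mul_zero] using hcol') hN₀ hN0 hN00 hNB hD hτ1 hτ2 hψ1 hψ2 hguard q Ωe.1

end Summit.HubbardSuperconductivity.HubbardSuperconductivity.Theorems.EngineV8

end
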